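import Summits.CriticalPhenomena.PercolationContinuityZ3.Theorems.PercNearOneGluingNoHeavyLowerTailCubicThreePointTerminalClosure
import Mathlib.Tactic.Ring
import Mathlib.Tactic.Linarith
import Mathlib.Tactic.Positivity
import HarnessLib

/-!
# `NoHeavyLowerTail` (stmt-CriticalPhenomena-4575) — hub-edge certificate, `Ha` side, Bernstein piece 0

Support file (prover prim-gen-kcluster gen 10, k-cluster line; `--supports stmt-CriticalPhenomena-4575`).  Pure polynomial algebra over `ℝ`;
no definitions, no named facts, no sorries.  One of the seven exact certificate pieces behind the HUB-EDGE THEOREM (assembled in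
`…CubicThreePointHubEdge`): for the smallest non-series–parallel three-terminal graph `H₂ = K_{2,3} +` hub edge (two hubs with arms
`a,b,c` / `A,B,C` to the terminals, hub–hub edge of probability `p`), the three-point law is the segment `L_p = (1−p)·w + p·z` between the
parallel composition `w = x ⊙ y` of the two star laws (`K_{2,3}`; the `join` of `…CubicThreePointSeriesParallel`) and the MERGED star `z`
(arms `a ⊕ A = a + A − aA`, …).  `Ha(L_p)` is a cubic in `p` with Bernstein coefficients `Ha(w)`, `Ha(w) + ⅓∇Ha(w)·(z−w)`,
`Ha(z) − ⅓∇Ha(z)·(z−w)`, `Ha(z)`.  THIS FILE: (three times) the zeroth coefficient, minus its share of the regime multiplier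
`(t − q)·E₁`, written in the box variables `x, x' = 1 − x`, is a polynomial with NONNEGATIVE INTEGER coefficients
(`hubEdge_C0`, 376 monomials; the identity holds in the free ring `ℤ[x, x']`, found by LP over the tensor-Bernstein basis and verified
exactly), hence `≥ 0` on `[0,1]⁶` (`hubEdge_C0_nonneg`).  Cells `(q,u₁,u₂,u₃,t) = (P(a|b|c),P(ab|c),P(ac|b),P(bc|a),P(abc))`, forms
`Ha = t·AG − e₃`, `Hb = q·AG − e₃` of `…CubicThreePointTerminalClosure`.  Memo: run/shared/lean/prim/prim-gen-kcluster/KCLUSTER-gen10.md §3.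
[cite: Gladkov2024StrongFKG, Cor. 4.2 (the quadratic form AG of the cell)]
-/

namespace Summit.CriticalPhenomena.PercolationContinuityZ3.Theorems

namespace CubicThreePointHub

open CubicThreePointTerminal

set_option maxRecDepth 16384 in
set_option maxHeartbeats 4000000 in
/-- Certificate identity (Ha side, piece 0) in the free variables `x, x'` (no relation `x' = 1 − x` is used): the left side equals a
polynomial with nonnegative integer coefficients. [folklore] -/
theorem hubEdge_C0 {a a' b b' c c' A A' B B' C C' qw w₁ w₂ w₃ tw  : ℝ}
    (hqw : qw = (a' * b' * c' + a * b' * c' + a' * b * c' + a' * b' * c) * (A' * B' * C' + A * B' * C' + A' * B * C' + A' * B' * C))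
    (hw₁ : w₁ = (a' * b' * c' + a * b' * c' + a' * b * c' + a' * b' * c) * (A * B * C') + a * b * c' * (A' * B' * C' + A * B' * C' + A' * B * C'
        + A' * B' * C) + a * b * c' * (A * B * C'))
    (hw₂ : w₂ = (a' * b' * c' + a * b' * c' + a' * b * c' + a' * b' * c) * (A * C * B') + a * c * b' * (A' * B' * C' + A * B' * C' + A' * B * C'
        + A' * B' * C) + a * c * b' * (A * C * B'))
    (hw₃ : w₃ = (a' * b' * c' + a * b' * c' + a' * b * c' + a' * b' * c) * (B * C * A') + b * c * a' * (A' * B' * C' + A * B' * C' + A' * B * C'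
        + A' * B' * C) + b * c * a' * (B * C * A'))
    (htw : tw = a * b * c * ((A' * B' * C' + A * B' * C' + A' * B * C' + A' * B' * C) + A * B * C' + A * C * B' + B * C * A' + A * B * C)
        + A * B * C * ((a' * b' * c' + a * b' * c' + a' * b * c' + a' * b' * c) + a * b * c' + a * c * b' + b * c * a')
       
        + (a * b * c' * (A * C * B' + B * C * A') + a * c * b' * (A * B * C' + B * C * A') + b * c * a' * (A * B * C' + A * C * B'))) :
    Ha qw w₁ w₂ w₃ tw - (tw - qw) * ((a' * a' * (b * (b' * (c * (c' * (A * A * (B * (B' * (C * (C')))))) + c * c * (A * A * (B * (B' * (C * (C')))))))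
        + b * b * (c * (c' * (A * A * (B * (B' * (C * (C'))))))))) + a * (a' * ((b' * b' * (c * (c' * (A * (A' * (B * B * (C * (C'))))))
        + c * c * (A * (A' * (B * B * (C * (C'))))))) + b * (b' * (c' * c' * (A * (A' * (B * (B' * (C * C))))) + c * c * (A * (A' * (B * (B' * (C' * C'))
        + B * B * (C' * C' + C * (C')))) + A * A * (B * (B' * (C' * C' + C * (C'))))))) + b * b * (c' * c' * (A * (A' * (B * (B' * (C * C)))))
        + c * (c' * (A * (A' * ((B' * B' * (C * (C') + C * C)) + B * (B' * (C * C)))) + A * A * (B' * B' * (C * (C')) + B * (B' * (C * (C')))))))))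
        + a * a * (b' * b' * (c * (c' * (A * (A' * (B * B * (C * (C'))))))) + b * (b' * (c' * c' * (A * (A' * (B * (B' * (C * C)))))
        + c * (c' * ((A' * A' * (B * (B' * (C * (C') + C * C)) + B * B * (C * (C')))) + A * (A' * (B * (B' * (C * C)) + B * B * (C * (C'))))))))))
    = (a' * a' * a' * (b * (b' * b' * (c * (c' * c' * (A * A * (A' * (B * (B' * B' * (C * C * (C'))) + B * B * (B' * (C * (C' * C') + C * C * (C')))))))
      + c * c * (c' * (A * A * (A' * (B * (B' * B' * (C * C * (2 * C'))) + B * B * (B' * (C * (2 * C' * C') + C * C * (2 * C')))))))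
      + c * c * c * (A * A * (A' * (B * (B' * B' * (C * C * (C'))) + B * B * (B' * (C * (C' * C') + C * C * (C'))))))))
      + b * b * (b' * (c * (c' * c' * (A * A * (A' * (B * (B' * B' * (C * C * (2 * C'))) + B * B * (B' * (C * (2 * C' * C') + C * C * (2 * C')))))))
      + c * c * (c' * (A * A * (A' * (B * (B' * B' * (C * C * (3 * C'))) + B * B * (B' * (C * (3 * C' * C') + C * C * (3 * C')))))))
      + c * c * c * (A * A * (A' * (B * (B' * B' * (C * C * (C'))) + B * B * (B' * (C * (C' * C') + C * C * (C'))))))))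
      + b * b * b * (c * (c' * c' * (A * A * (A' * (B * (B' * B' * (C * C * (C'))) + B * B * (B' * (C * (C' * C') + C * C * (C')))))))
      + c * c * (c' * (A * A * (A' * (B * (B' * B' * (C * C * (C'))) + B * B * (B' * (C * (C' * C') + C * C * (C'))))))))))
      + a * (a' * a' * ((b' * b' * b' * (c * (c' * c' * (A * (A' * A' * (B * B * (B' * (C * C * (C'))))) + A * A * (A' * (B * B * (B' * (C * (C' * C')
      + C * C * (C'))))))) + c * c * (c' * (A * (A' * A' * (B * B * (B' * (C * C * (2 * C'))))) + A * A * (A' * (B * B * (B' * (C * (2 * C' * C')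
      + C * C * (2 * C'))))))) + c * c * c * (A * (A' * A' * (B * B * (B' * (C * C * (C'))))) + A * A * (A' * (B * B * (B' * (C * (C' * C')
      + C * C * (C')))))))) + b * (b' * b' * ((c' * c' * c' * (A * (A' * A' * (B * B * (B' * (C * C * (C'))))) + A * A * (A' * (B * (B' * B' * (C * C * (C')))
      + B * B * (B' * (C * C * (C'))))))) + c * (c' * c' * (A * (A' * A' * (B * (B' * B' * (C * (2 * C' * C') + C * C * (2 * C')))
      + B * B * (B' * (C * (2 * C' * C') + C * C * (6 * C') + C * C * C)) + B * B * B * (C * C * (C')))) + A * A * (A' * (B * (B' * B' * (C * (2 * C' * C')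
      + C * C * (6 * C') + C * C * C)) + B * B * (B' * (C * (6 * C' * C') + C * C * (11 * C') + 2 * C * C * C)) + B * B * B * (C * (C' * C')
      + C * C * (2 * C')))) + A * A * A * (B * (B' * B' * (C * C * (C'))) + B * B * (B' * (C * (C' * C') + C * C * (2 * C'))))))
      + c * c * (c' * (A * (A' * A' * (B * (B' * B' * (C * (2 * C' * C') + C * C * (2 * C'))) + B * B * (B' * (C * (2 * C' * C') + C * C * (7 * C')
      + C * C * C)) + B * B * B * (C * C * (C')))) + A * A * (A' * (B * (B' * B' * (C * (2 * C' * C') + C * C * (7 * C') + C * C * C))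
      + B * B * (B' * (C * (9 * C' * C') + C * C * (14 * C') + 2 * C * C * C)) + B * B * B * (C * (C' * C') + C * C * (2 * C'))))
      + A * A * A * (B * (B' * B' * (C * C * (C'))) + B * B * (B' * (C * (C' * C') + C * C * (2 * C'))))))
      + c * c * c * (A * (A' * A' * (B * B * (B' * (C * C * (2 * C'))))) + A * A * (A' * (B * (B' * B' * (C * C * (2 * C')))
      + B * B * (B' * (C * (3 * C' * C') + C * C * (4 * C')))))))) + b * b * (b' * ((c' * c' * c' * (A * (A' * A' * (B * B * (B' * (C * C * (2 * C')))))
      + A * A * (A' * (B * (B' * B' * (C * C * (2 * C'))) + B * B * (B' * (C * C * (2 * C')))))))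
      + c * (c' * c' * (A * (A' * A' * (B * (B' * B' * (C * (2 * C' * C') + C * C * (2 * C'))) + B * B * (B' * (C * (2 * C' * C') + C * C * (7 * C')
      + C * C * C)) + B * B * B * (C * C * (C')))) + A * A * (A' * (B * (B' * B' * (C * (2 * C' * C') + C * C * (9 * C') + C * C * C))
      + B * B * (B' * (C * (7 * C' * C') + C * C * (14 * C') + 2 * C * C * C)) + B * B * B * (C * (C' * C') + C * C * (2 * C'))))
      + A * A * A * (B * (B' * B' * (C * C * (C'))) + B * B * (B' * (C * (C' * C') + C * C * (2 * C'))))))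
      + c * c * (c' * (A * (A' * A' * ((B' * B' * B' * (C * (C' * C') + C * C * (2 * C') + C * C * C)) + B * (B' * B' * (C' * C' * C' + C * (6 * C' * C')
      + C * C * (7 * C') + 2 * C * C * C)) + B * B * (B' * (2 * C' * C' * C' + C * (7 * C' * C') + C * C * (10 * C') + C * C * C)) + B * B * B * (C' * C' * C'
      + C * (2 * C' * C') + C * C * (C')))) + A * A * (A' * ((B' * B' * B' * (C * (2 * C' * C') + C * C * (3 * C') + C * C * C))
      + B * (B' * B' * (2 * C' * C' * C' + C * (9 * C' * C') + C * C * (15 * C') + 3 * C * C * C)) + B * B * (B' * (3 * C' * C' * C' + C * (15 * C' * C')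
      + C * C * (18 * C') + 2 * C * C * C)) + B * B * B * (C' * C' * C' + C * (3 * C' * C') + C * C * (2 * C'))))
      + A * A * A * ((B' * B' * B' * (C * (C' * C') + C * C * (C'))) + B * (B' * B' * (C' * C' * C' + C * (3 * C' * C') + C * C * (3 * C')))
      + B * B * (B' * (C' * C' * C' + C * (3 * C' * C') + C * C * (2 * C')))))) + c * c * c * (A * (A' * A' * (B * (B' * B' * (C * (C' * C') + C * C * (C')))
      + B * B * (B' * (C * (C' * C') + C * C * (C'))))) + A * A * (A' * (B * (B' * B' * (C * (C' * C') + C * C * (3 * C'))) + B * B * (B' * (C * (3 * C' * C')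
      + C * C * (3 * C')))))))) + b * b * b * ((c' * c' * c' * (A * (A' * A' * (B * B * (B' * (C * C * (C')))))
      + A * A * (A' * (B * (B' * B' * (C * C * (C'))) + B * B * (B' * (C * C * (C')))))))
      + c * (c' * c' * (A * (A' * A' * (B * B * (B' * (C * C * (2 * C'))))) + A * A * (A' * (B * (B' * B' * (C * C * (3 * C')))
      + B * B * (B' * (C * (2 * C' * C') + C * C * (4 * C'))))))) + c * c * (c' * (A * (A' * A' * (B * (B' * B' * (C * (C' * C') + C * C * (C')))
      + B * B * (B' * (C * (C' * C') + C * C * (C'))))) + A * A * (A' * (B * (B' * B' * (C * (C' * C') + C * C * (3 * C'))) + B * B * (B' * (C * (3 * C' * C')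
      + C * C * (3 * C')))))))))) + a * a * (a' * ((b' * b' * b' * (c * (c' * c' * (A * (A' * A' * (B * B * (B' * (C * C * (2 * C')))))
      + A * A * (A' * (B * B * (B' * (C * (2 * C' * C') + C * C * (2 * C'))))))) + c * c * (c' * (A * (A' * A' * (B * B * (B' * (C * C * (3 * C')))))
      + A * A * (A' * (B * B * (B' * (C * (3 * C' * C') + C * C * (3 * C'))))))) + c * c * c * (A * (A' * A' * (B * B * (B' * (C * C * (C')))))
      + A * A * (A' * (B * B * (B' * (C * (C' * C') + C * C * (C'))))))))
      + b * (b' * b' * ((c' * c' * c' * (A * (A' * A' * (B * B * (B' * (C * C * (2 * C'))))) + A * A * (A' * (B * (B' * B' * (C * C * (2 * C')))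
      + B * B * (B' * (C * C * (2 * C'))))))) + c * (c' * c' * (A * (A' * A' * (B * (B' * B' * (C * (2 * C' * C') + C * C * (2 * C')))
      + B * B * (B' * (C * (2 * C' * C') + C * C * (9 * C') + C * C * C)) + B * B * B * (C * C * (C')))) + A * A * (A' * (B * (B' * B' * (C * (2 * C' * C')
      + C * C * (7 * C') + C * C * C)) + B * B * (B' * (C * (7 * C' * C') + C * C * (14 * C') + 2 * C * C * C)) + B * B * B * (C * (C' * C')
      + C * C * (2 * C')))) + A * A * A * (B * (B' * B' * (C * C * (C'))) + B * B * (B' * (C * (C' * C') + C * C * (2 * C'))))))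
      + c * c * (c' * ((A' * A' * A' * (B * (B' * B' * (C * (C' * C') + C * C * (2 * C') + C * C * C)) + B * B * (B' * (C * (2 * C' * C') + C * C * (3 * C')
      + C * C * C)) + B * B * B * (C * (C' * C') + C * C * (C')))) + A * (A' * A' * (B * (B' * B' * (C' * C' * C' + C * (6 * C' * C') + C * C * (7 * C')
      + 2 * C * C * C)) + B * B * (B' * (2 * C' * C' * C' + C * (9 * C' * C') + C * C * (15 * C') + 3 * C * C * C)) + B * B * B * (C' * C' * C'
      + C * (3 * C' * C') + C * C * (3 * C')))) + A * A * (A' * (B * (B' * B' * (2 * C' * C' * C' + C * (7 * C' * C') + C * C * (10 * C') + C * C * C))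
      + B * B * (B' * (3 * C' * C' * C' + C * (15 * C' * C') + C * C * (18 * C') + 2 * C * C * C)) + B * B * B * (C' * C' * C' + C * (3 * C' * C')
      + C * C * (2 * C')))) + A * A * A * (B * (B' * B' * (C' * C' * C' + C * (2 * C' * C') + C * C * (C'))) + B * B * (B' * (C' * C' * C' + C * (3 * C' * C')
      + C * C * (2 * C')))))) + c * c * c * (A * (A' * A' * (B * (B' * B' * (C * (C' * C') + C * C * (C'))) + B * B * (B' * (C * (C' * C')
      + C * C * (3 * C'))))) + A * A * (A' * (B * (B' * B' * (C * (C' * C') + C * C * (C'))) + B * B * (B' * (C * (3 * C' * C') + C * C * (3 * C'))))))))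
      + b * b * (b' * ((c' * c' * c' * (A * (A' * A' * (B * B * (B' * (C * C * (3 * C'))))) + A * A * (A' * (B * (B' * B' * (C * C * (3 * C')))
      + B * B * (B' * (C * C * (3 * C'))))))) + c * (c' * c' * ((A' * A' * A' * (B * (B' * B' * (C * (C' * C') + C * C * (2 * C') + C * C * C))
      + B * B * (B' * (C * (2 * C' * C') + C * C * (3 * C') + C * C * C)) + B * B * B * (C * (C' * C') + C * C * (C'))))
      + A * (A' * A' * ((B' * B' * B' * (C * (C' * C') + C * C * (2 * C') + C * C * C)) + B * (B' * B' * (C * (6 * C' * C') + C * C * (9 * C')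
      + 3 * C * C * C)) + B * B * (B' * (C * (7 * C' * C') + C * C * (15 * C') + 3 * C * C * C)) + B * B * B * (C * (2 * C' * C') + C * C * (3 * C'))))
      + A * A * (A' * ((B' * B' * B' * (C * (2 * C' * C') + C * C * (3 * C') + C * C * C)) + B * (B' * B' * (C * (7 * C' * C') + C * C * (15 * C')
      + 3 * C * C * C)) + B * B * (B' * (C * (10 * C' * C') + C * C * (18 * C') + 2 * C * C * C)) + B * B * B * (C * (C' * C') + C * C * (2 * C'))))
      + A * A * A * ((B' * B' * B' * (C * (C' * C') + C * C * (C'))) + B * (B' * B' * (C * (2 * C' * C') + C * C * (3 * C'))) + B * B * (B' * (C * (C' * C')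
      + C * C * (2 * C')))))) + c * c * (c' * ((A' * A' * A' * (B * (B' * B' * (C * (C' * C') + C * C * (2 * C') + C * C * C))
      + B * B * (B' * (C * (2 * C' * C') + C * C * (3 * C') + C * C * C)) + B * B * B * (C * (C' * C') + C * C * (C'))))
      + A * (A' * A' * ((B' * B' * B' * (C * (C' * C') + C * C * (2 * C') + C * C * C)) + B * (B' * B' * (C' * C' * C' + C * (11 * C' * C')
      + C * C * (14 * C') + 4 * C * C * C)) + B * B * (B' * (2 * C' * C' * C' + C * (14 * C' * C') + C * C * (18 * C') + 3 * C * C * C))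
      + B * B * B * (C' * C' * C' + C * (4 * C' * C') + C * C * (3 * C')))) + A * A * (A' * ((B' * B' * B' * (C * (2 * C' * C') + C * C * (3 * C')
      + C * C * C)) + B * (B' * B' * (2 * C' * C' * C' + C * (14 * C' * C') + C * C * (18 * C') + 3 * C * C * C)) + B * B * (B' * (3 * C' * C' * C'
      + C * (18 * C' * C') + C * C * (18 * C') + 2 * C * C * C)) + B * B * B * (C' * C' * C' + C * (3 * C' * C') + C * C * (2 * C'))))
      + A * A * A * ((B' * B' * B' * (C * (C' * C') + C * C * (C'))) + B * (B' * B' * (C' * C' * C' + C * (4 * C' * C') + C * C * (3 * C')))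
      + B * B * (B' * (C' * C' * C' + C * (3 * C' * C') + C * C * (2 * C')))))) + c * c * c * (A * (A' * A' * (B * (B' * B' * (C * (2 * C' * C')
      + C * C * (2 * C'))) + B * B * (B' * (C * (2 * C' * C') + C * C * (2 * C'))))) + A * A * (A' * (B * (B' * B' * (C * (2 * C' * C') + C * C * (2 * C')))
      + B * B * (B' * (C * (2 * C' * C') + C * C * (2 * C')))))))) + b * b * b * ((c' * c' * c' * (A * (A' * A' * (B * B * (B' * (C * C * (C')))))
      + A * A * (A' * (B * (B' * B' * (C * C * (C'))) + B * B * (B' * (C * C * (C'))))))) + c * (c' * c' * (A * (A' * A' * (B * (B' * B' * (C * (C' * C')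
      + C * C * (C'))) + B * B * (B' * (C * (C' * C') + C * C * (3 * C'))))) + A * A * (A' * (B * (B' * B' * (C * (C' * C') + C * C * (3 * C')))
      + B * B * (B' * (C * (C' * C') + C * C * (3 * C'))))))) + c * c * (c' * (A * (A' * A' * (B * (B' * B' * (C * (2 * C' * C') + C * C * (2 * C')))
      + B * B * (B' * (C * (2 * C' * C') + C * C * (2 * C'))))) + A * A * (A' * (B * (B' * B' * (C * (2 * C' * C') + C * C * (2 * C')))
      + B * B * (B' * (C * (2 * C' * C') + C * C * (2 * C'))))))))))
      + a * a * a * ((b' * b' * b' * (c * (c' * c' * (A * (A' * A' * (B * B * (B' * (C * C * (C'))))) + A * A * (A' * (B * B * (B' * (C * (C' * C')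
      + C * C * (C'))))))) + c * c * (c' * (A * (A' * A' * (B * B * (B' * (C * C * (C'))))) + A * A * (A' * (B * B * (B' * (C * (C' * C')
      + C * C * (C'))))))))) + b * (b' * b' * ((c' * c' * c' * (A * (A' * A' * (B * B * (B' * (C * C * (C')))))
      + A * A * (A' * (B * (B' * B' * (C * C * (C'))) + B * B * (B' * (C * C * (C')))))))
      + c * (c' * c' * (A * (A' * A' * (B * B * (B' * (C * C * (3 * C'))))) + A * A * (A' * (B * (B' * B' * (C * C * (2 * C')))
      + B * B * (B' * (C * (2 * C' * C') + C * C * (4 * C'))))))) + c * c * (c' * (A * (A' * A' * (B * (B' * B' * (C * (C' * C') + C * C * (C')))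
      + B * B * (B' * (C * (C' * C') + C * C * (3 * C'))))) + A * A * (A' * (B * (B' * B' * (C * (C' * C') + C * C * (C'))) + B * B * (B' * (C * (3 * C' * C')
      + C * C * (3 * C'))))))))) + b * b * (b' * ((c' * c' * c' * (A * (A' * A' * (B * B * (B' * (C * C * (C')))))
      + A * A * (A' * (B * (B' * B' * (C * C * (C'))) + B * B * (B' * (C * C * (C'))))))) + c * (c' * c' * (A * (A' * A' * (B * (B' * B' * (C * (C' * C')
      + C * C * (C'))) + B * B * (B' * (C * (C' * C') + C * C * (3 * C'))))) + A * A * (A' * (B * (B' * B' * (C * (C' * C') + C * C * (3 * C')))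
      + B * B * (B' * (C * (C' * C') + C * C * (3 * C'))))))) + c * c * (c' * (A * (A' * A' * (B * (B' * B' * (C * (2 * C' * C') + C * C * (2 * C')))
      + B * B * (B' * (C * (2 * C' * C') + C * C * (2 * C'))))) + A * A * (A' * (B * (B' * B' * (C * (2 * C' * C') + C * C * (2 * C')))
      + B * B * (B' * (C * (2 * C' * C') + C * C * (2 * C')))))))))) := by
  subst hqw hw₁ hw₂ hw₃ htw 
  simp only [Ha]
  ring

set_option maxRecDepth 16384 in
set_option maxHeartbeats 4000000 in
/-- On the box `[0,1]⁶` (cells in the tree's star / parallel-composition form): the zeroth Bernstein piece (Ha side) dominates its share of the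
regime multiplier. [folklore] -/
theorem hubEdge_C0_nonneg {a b c A B C qw w₁ w₂ w₃ tw  : ℝ}
    (ha₀ : 0 ≤ a) (ha₁ : a ≤ 1) (hb₀ : 0 ≤ b) (hb₁ : b ≤ 1) (hc₀ : 0 ≤ c) (hc₁ : c ≤ 1)
    (hA₀ : 0 ≤ A) (hA₁ : A ≤ 1) (hB₀ : 0 ≤ B) (hB₁ : B ≤ 1) (hC₀ : 0 ≤ C) (hC₁ : C ≤ 1)
    (hqw : qw = (1 - (a * b + a * c + b * c) + 2 * (a * b * c)) * (1 - (A * B + A * C + B * C) + 2 * (A * B * C)))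
    (hw₁ : w₁ = (1 - (a * b + a * c + b * c) + 2 * (a * b * c)) * (A * B * (1 - C)) + a * b * (1 - c) * (1 - (A * B + A * C + B * C) + 2 * (A * B * C))
        + a * b * (1 - c) * (A * B * (1 - C)))
    (hw₂ : w₂ = (1 - (a * b + a * c + b * c) + 2 * (a * b * c)) * (A * C * (1 - B)) + a * c * (1 - b) * (1 - (A * B + A * C + B * C) + 2 * (A * B * C))
        + a * c * (1 - b) * (A * C * (1 - B)))
    (hw₃ : w₃ = (1 - (a * b + a * c + b * c) + 2 * (a * b * c)) * (B * C * (1 - A)) + b * c * (1 - a) * (1 - (A * B + A * C + B * C) + 2 * (A * B * C))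
        + b * c * (1 - a) * (B * C * (1 - A)))
    (htw : tw = a * b * c * ((1 - (A * B + A * C + B * C) + 2 * (A * B * C)) + A * B * (1 - C) + A * C * (1 - B) + B * C * (1 - A) + A * B * C)
        + A * B * C * ((1 - (a * b + a * c + b * c) + 2 * (a * b * c)) + a * b * (1 - c) + a * c * (1 - b) + b * c * (1 - a))
       
        + (a * b * (1 - c) * (A * C * (1 - B) + B * C * (1 - A)) + a * c * (1 - b) * (A * B * (1 - C) + B * C * (1 - A))
        + b * c * (1 - a) * (A * B * (1 - C) + A * C * (1 - B)))) :
    0 ≤ Ha qw w₁ w₂ w₃ tw - (tw - qw) * (((1 - a) * (1 - a) * (b * ((1 - b) * (c * ((1 - c) * (A * A * (B * ((1 - B) * (C * ((1 - C)))))))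
        + c * c * (A * A * (B * ((1 - B) * (C * ((1 - C)))))))) + b * b * (c * ((1 - c) * (A * A * (B * ((1 - B) * (C * ((1 - C))))))))))
        + a * ((1 - a) * (((1 - b) * (1 - b) * (c * ((1 - c) * (A * ((1 - A) * (B * B * (C * ((1 - C)))))))
        + c * c * (A * ((1 - A) * (B * B * (C * ((1 - C)))))))) + b * ((1 - b) * ((1 - c) * (1 - c) * (A * ((1 - A) * (B * ((1 - B) * (C * C)))))
        + c * c * (A * ((1 - A) * (B * ((1 - B) * ((1 - C) * (1 - C))) + B * B * ((1 - C) * (1 - C) + C * ((1 - C)))))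
        + A * A * (B * ((1 - B) * ((1 - C) * (1 - C) + C * ((1 - C)))))))) + b * b * ((1 - c) * (1 - c) * (A * ((1 - A) * (B * ((1 - B) * (C * C)))))
        + c * ((1 - c) * (A * ((1 - A) * (((1 - B) * (1 - B) * (C * ((1 - C)) + C * C)) + B * ((1 - B) * (C * C))))
        + A * A * ((1 - B) * (1 - B) * (C * ((1 - C))) + B * ((1 - B) * (C * ((1 - C))))))))))
        + a * a * ((1 - b) * (1 - b) * (c * ((1 - c) * (A * ((1 - A) * (B * B * (C * ((1 - C))))))))
        + b * ((1 - b) * ((1 - c) * (1 - c) * (A * ((1 - A) * (B * ((1 - B) * (C * C))))) + c * ((1 - c) * (((1 - A) * (1 - A) * (B * ((1 - B) * (C * ((1 - C))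
        + C * C)) + B * B * (C * ((1 - C))))) + A * ((1 - A) * (B * ((1 - B) * (C * C)) + B * B * (C * ((1 - C))))))))))) := by
  have hqw' : qw = ((1 - a) * (1 - b) * (1 - c) + a * (1 - b) * (1 - c) + (1 - a) * b * (1 - c)
      + (1 - a) * (1 - b) * c) * ((1 - A) * (1 - B) * (1 - C) + A * (1 - B) * (1 - C) + (1 - A) * B * (1 - C) + (1 - A) * (1 - B) * C) := by
    rw [hqw]; ring
  have hw₁' : w₁ = ((1 - a) * (1 - b) * (1 - c) + a * (1 - b) * (1 - c) + (1 - a) * b * (1 - c) + (1 - a) * (1 - b) * c) * (A * B * (1 - C))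
      + a * b * (1 - c) * ((1 - A) * (1 - B) * (1 - C) + A * (1 - B) * (1 - C) + (1 - A) * B * (1 - C) + (1 - A) * (1 - B) * C)
      + a * b * (1 - c) * (A * B * (1 - C)) := by
    rw [hw₁]; ring
  have hw₂' : w₂ = ((1 - a) * (1 - b) * (1 - c) + a * (1 - b) * (1 - c) + (1 - a) * b * (1 - c) + (1 - a) * (1 - b) * c) * (A * C * (1 - B))
      + a * c * (1 - b) * ((1 - A) * (1 - B) * (1 - C) + A * (1 - B) * (1 - C) + (1 - A) * B * (1 - C) + (1 - A) * (1 - B) * C)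
      + a * c * (1 - b) * (A * C * (1 - B)) := by
    rw [hw₂]; ring
  have hw₃' : w₃ = ((1 - a) * (1 - b) * (1 - c) + a * (1 - b) * (1 - c) + (1 - a) * b * (1 - c) + (1 - a) * (1 - b) * c) * (B * C * (1 - A))
      + b * c * (1 - a) * ((1 - A) * (1 - B) * (1 - C) + A * (1 - B) * (1 - C) + (1 - A) * B * (1 - C) + (1 - A) * (1 - B) * C)
      + b * c * (1 - a) * (B * C * (1 - A)) := by
    rw [hw₃]; ring
  have htw' : tw = a * b * c * (((1 - A) * (1 - B) * (1 - C) + A * (1 - B) * (1 - C) + (1 - A) * B * (1 - C) + (1 - A) * (1 - B) * C)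
      + A * B * (1 - C) + A * C * (1 - B) + B * C * (1 - A) + A * B * C) + A * B * C * (((1 - a) * (1 - b) * (1 - c)
      + a * (1 - b) * (1 - c) + (1 - a) * b * (1 - c) + (1 - a) * (1 - b) * c) + a * b * (1 - c) + a * c * (1 - b)
      + b * c * (1 - a))
        + (a * b * (1 - c) * (A * C * (1 - B) + B * C * (1 - A)) + a * c * (1 - b) * (A * B * (1 - C)
      + B * C * (1 - A)) + b * c * (1 - a) * (A * B * (1 - C) + A * C * (1 - B))) := by
    rw [htw]; ring
  rw [hubEdge_C0 hqw' hw₁' hw₂' hw₃' htw' ]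
  set a' := 1 - a with ha
  set b' := 1 - b with hb
  set c' := 1 - c with hc
  set A' := 1 - A with hA
  set B' := 1 - B with hB
  set C' := 1 - C with hC
  have ha' : 0 ≤ a' := by linarith
  have hb' : 0 ≤ b' := by linarith
  have hc' : 0 ≤ c' := by linarith
  have hA' : 0 ≤ A' := by linarith
  have hB' : 0 ≤ B' := by linarith
  have hC' : 0 ≤ C' := by linarith
  positivity

end CubicThreePointHub

end Summit.CriticalPhenomena.PercolationContinuityZ3.Theorems
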